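import Literature.NumberTheory.Sieve.LargestPrimeFactorCubicRootPairs
import HarnessLib

/-!
# Heath-Brown 2001 (PLMS), Lemma 11: passing from `R` to `R′ = R/(R,d)` — the fibres of
# `(r, k) ↦ (r/(r,d), k mod r/(r,d))` on the root pairs

Topic `Literature/NumberTheory/Sieve`; a PROVED combinatorial layer (no named facts) under the named fact
`Irving2015_largestPrimeFactor_cubic` (`LargestPrimeFactorCubic.lean`), an input of Heath-Brown's
**Lemma 11** (main-term programme, Lemma 7).  Source: D. R. Heath-Brown, *The largest prime factor of
`X³ + 2`*, Proc. London Math. Soc. (3) 82 (2001) 554–596, §7 p. 26: "If we now write `S = (R, d)` and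
`R = ST` once more, it follows via Lemma 10 that the overall contribution from terms of (7.3) and (7.4)
with `d ≤ Δ` is `≪ ∑_{N(R)≤Q, ρ(R)=1} ∑_{d≤Δ} |S(R/(R,d); …) − (M/d)²/N(R/(R,d))| ≪ ∑_{d≤Δ} ∑_{N(S)∣d}
∑_{N(T)≤Q/N(S), ρ(T)=1} |S(T; …) − (M/d)²/N(T)|`".  In root language `R ↔ (r, k)`, `N(S) = s =
(r, d)`, `T ↔ (r/s, k mod r/s)`, and the passage costs the fibre size, at most `s`:

* `mod_mem_rootsCube` — `k ∈ rootsCube r`, `r′ ∣ r` ⇒ `k mod r′ ∈ rootsCube r′`;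
* `card_fibre_le` — `#{k < s r′ : k mod r′ = k′} ≤ s`;
* **`sum_rootPairs_comp_le`** — for `F ≥ 0` and `d ≥ 1`,
  `∑_{(r,k) ∈ rootPairs Q} F(r/(r,d), k mod r/(r,d)) ≤ ∑_{s ∣ d} s · ∑_{(r′,k′) ∈ rootPairs (Q/s)} F(r′, k′)`.

## References

* D. R. Heath-Brown, *The largest prime factor of `X³ + 2`*, Proc. London Math. Soc. (3) 82 (2001)
  554–596, §7 p. 26. [`HeathBrown2001LargestPrimeFactorCubic`]

## Mathlib / tree search

Tree: `rootsCube`, `mem_rootsCube`, `rootPairs` (`…RootPairs`).  Mathlib: `Finset.sum_fiberwise_of_maps_to`,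
`Finset.card_le_card_of_injOn`, `Int.emod_emod_of_dvd`, `Nat.div_le_div_right`.
-/

noncomputable section

open Finset

namespace Literature.NumberTheory.Sieve.HeathBrown2001

/-! ### Reduction of roots and the fibre count -/

/-- A cube root of `2` modulo `r` reduces to one modulo any `r′ ∣ r` (`r′ ≥ 1`). [folklore] -/
theorem mod_mem_rootsCube {r r' k : ℕ} (hr' : 0 < r') (hdvd : r' ∣ r) (hk : k ∈ rootsCube r) :
    k % r' ∈ rootsCube r' := by
  rw [mem_rootsCube] at hk ⊢
  refine ⟨Nat.mod_lt _ hr', ?_⟩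
  have h1 : ((r' : ℕ) : ℤ) ∣ (k : ℤ) ^ 3 - 2 := (Int.natCast_dvd_natCast.mpr hdvd).trans hk.2
  have h2 : ((r' : ℕ) : ℤ) ∣ ((k % r' : ℕ) : ℤ) ^ 3 - (k : ℤ) ^ 3 := by
    have hsub : ((r' : ℕ) : ℤ) ∣ ((k % r' : ℕ) : ℤ) - (k : ℤ) := by
      rw [Int.natCast_mod, ← dvd_neg, neg_sub]
      exact Int.dvd_self_sub_emod
    obtain ⟨t, ht⟩ := hsub
    refine ⟨t * (((k % r' : ℕ) : ℤ) ^ 2 + ((k % r' : ℕ) : ℤ) * k + (k : ℤ) ^ 2), ?_⟩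
    have : ((k % r' : ℕ) : ℤ) = (k : ℤ) + r' * t := by linarith
    rw [this]; ring
  have := dvd_add h2 h1
  rwa [show ((k % r' : ℕ) : ℤ) ^ 3 - (k : ℤ) ^ 3 + ((k : ℤ) ^ 3 - 2) = ((k % r' : ℕ) : ℤ) ^ 3 - 2 by ring] at this

/-- `#{k < s r′ : k mod r′ = k′} ≤ s`. [folklore] -/
theorem card_fibre_le (s r' k' : ℕ) (hr' : 0 < r') :
    #((range (s * r')).filter fun k : ℕ => k % r' = k') ≤ s := by
  rcases Nat.lt_or_ge k' r' with hk' | hk'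
  · -- the solutions are `k′ + r′ t`, `t < s`
    have hsub : (range (s * r')).filter (fun k : ℕ => k % r' = k') ⊆ (range s).image fun t => k' + r' * t := by
      intro k hk
      rw [mem_filter, mem_range] at hk
      rw [mem_image]
      refine ⟨k / r', ?_, ?_⟩
      · rw [mem_range, Nat.div_lt_iff_lt_mul hr']; linarith [hk.1]
      · have := Nat.mod_add_div k r'; rw [hk.2] at this; linarith
    calc #((range (s * r')).filter fun k : ℕ => k % r' = k') ≤ #((range s).image fun t => k' + r' * t) :=
          card_le_card hsub
      _ ≤ #(range s) := card_image_le
      _ = s := card_range s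
  · -- no solutions
    have : (range (s * r')).filter (fun k : ℕ => k % r' = k') = ∅ := by
      rw [filter_eq_empty_iff]
      intro k _ hk
      have := Nat.mod_lt k hr'
      omega
    rw [this, card_empty]; exact Nat.zero_le _

/-! ### The regrouping inequality -/

/-- **From `(r, k)` to `(r/(r,d), k mod r/(r,d))`**: for `F ≥ 0`, `d ≥ 1`,
`∑_{(r,k) ∈ rootPairs Q} F(r/(r,d), k mod (r/(r,d))) ≤ ∑_{s ∣ d} s ∑_{(r′,k′) ∈ rootPairs (Q/s)} F(r′, k′)`.
[cite: HeathBrown2001LargestPrimeFactorCubic, §7 p. 26] -/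
theorem sum_rootPairs_comp_le {Q d : ℕ} (hd : 0 < d) (F : ℕ → ℕ → ℝ) (hF : ∀ r k, 0 ≤ F r k) :
    ∑ qk ∈ rootPairs Q, F (qk.1 / Nat.gcd qk.1 d) (qk.2 % (qk.1 / Nat.gcd qk.1 d)) ≤
      ∑ s ∈ d.divisors, (s : ℝ) * ∑ qk ∈ rootPairs (Q / s), F qk.1 qk.2 := by
  classical
  -- Step 1: group by `s = (r, d)`
  have hmaps : ∀ qk ∈ rootPairs Q, Nat.gcd qk.1 d ∈ d.divisors := fun qk _ =>
    Nat.mem_divisors.mpr ⟨Nat.gcd_dvd_right _ _, hd.ne'⟩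
  rw [← sum_fiberwise_of_maps_to hmaps]
  refine sum_le_sum fun s hs => ?_
  have hs0 : 0 < s := Nat.pos_of_mem_divisors hs
  -- Step 2: on the class `(r,d) = s`, map to `rootPairs (Q/s)` with fibres of size `≤ s`
  set A := (rootPairs Q).filter fun qk => Nat.gcd qk.1 d = s with hA
  set g : (Σ _ : ℕ, ℕ) → (Σ _ : ℕ, ℕ) := fun qk => ⟨qk.1 / s, qk.2 % (qk.1 / s)⟩ with hg
  have hval : ∀ qk ∈ A, F (qk.1 / Nat.gcd qk.1 d) (qk.2 % (qk.1 / Nat.gcd qk.1 d)) = F (g qk).1 (g qk).2 := by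
    intro qk hqk
    rw [hA, mem_filter] at hqk
    rw [hqk.2]
  rw [sum_congr rfl hval]
  have hmaps2 : ∀ qk ∈ A, g qk ∈ rootPairs (Q / s) := by
    intro qk hqk
    rw [hA, mem_filter] at hqk
    obtain ⟨hmem, hgcd⟩ := hqk
    unfold rootPairs at hmem ⊢
    rw [mem_sigma, mem_Icc] at hmem ⊢
    obtain ⟨⟨h1, h2⟩, hk⟩ := hmem
    have hsr : s ∣ qk.1 := hgcd ▸ Nat.gcd_dvd_left _ _
    have hr'0 : 0 < qk.1 / s := Nat.div_pos (Nat.le_of_dvd h1 hsr) hs0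
    refine ⟨⟨hr'0, Nat.div_le_div_right h2⟩, ?_⟩
    exact mod_mem_rootsCube hr'0 (Nat.div_dvd_of_dvd hsr) hk
  rw [← sum_fiberwise_of_maps_to hmaps2, mul_sum]
  refine sum_le_sum fun y hy => ?_
  have hr'0 : 0 < y.1 := by
    unfold rootPairs at hy; rw [mem_sigma, mem_Icc] at hy; exact hy.1.1
  -- on the fibre over `y = (r′, k′)` the summand is the constant `F r′ k′`
  have hconst : ∑ qk ∈ A.filter (fun qk => g qk = y), F (g qk).1 (g qk).2 =
      #(A.filter fun qk => g qk = y) * F y.1 y.2 := by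
    have hc : ∀ qk ∈ A.filter (fun qk => g qk = y), F (g qk).1 (g qk).2 = F y.1 y.2 :=
      fun qk hqk => by rw [(mem_filter.mp hqk).2]
    rw [sum_congr rfl hc, sum_const, nsmul_eq_mul]
  rw [hconst]
  refine mul_le_mul_of_nonneg_right ?_ (hF _ _)
  -- the fibre has at most `s` elements: `r = s r′` is determined and `k < s r′`, `k ≡ k′ (mod r′)`
  have hinj : Set.InjOn (fun qk : (Σ _ : ℕ, ℕ) => qk.2) (A.filter fun qk => g qk = y : Set (Σ _ : ℕ, ℕ)) := by
    intro x hx x' hx' h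
    simp only [coe_filter, Set.mem_setOf_eq, hA, mem_filter] at hx hx'
    obtain ⟨⟨-, hgx⟩, hx2⟩ := hx
    obtain ⟨⟨-, hgx'⟩, hx2'⟩ := hx'
    have h1 : x.1 = s * y.1 := by
      have := congr_arg Sigma.fst hx2; simp only [hg] at this
      rw [← this, Nat.mul_div_cancel' (hgx ▸ Nat.gcd_dvd_left _ _)]
    have h1' : x'.1 = s * y.1 := by
      have := congr_arg Sigma.fst hx2'; simp only [hg] at this
      rw [← this, Nat.mul_div_cancel' (hgx' ▸ Nat.gcd_dvd_left _ _)]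
    ext
    · rw [h1, h1']
    · exact heq_of_eq h
  have hmaps3 : ∀ qk ∈ A.filter (fun qk => g qk = y), (fun qk : (Σ _ : ℕ, ℕ) => qk.2) qk ∈
      (range (s * y.1)).filter fun k : ℕ => k % y.1 = y.2 := by
    intro qk hqk
    rw [hA, mem_filter, mem_filter] at hqk
    obtain ⟨⟨hmem, hgcd⟩, hgy⟩ := hqk
    have hsr : s ∣ qk.1 := hgcd ▸ Nat.gcd_dvd_left _ _
    have h1 : qk.1 = s * y.1 := by
      have := congr_arg Sigma.fst hgy; simp only [hg] at this
      rw [← this, Nat.mul_div_cancel' hsr]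
    have h2 : qk.2 % (qk.1 / s) = y.2 := by
      have := congr_arg Sigma.snd hgy
      simpa only [hg] using this
    rw [mem_filter, mem_range]
    unfold rootPairs at hmem
    rw [mem_sigma] at hmem
    have hk := (mem_rootsCube.mp hmem.2).1
    refine ⟨by rw [← h1]; exact hk, ?_⟩
    rw [← h2, h1, Nat.mul_div_cancel_left _ hs0]
  calc (#(A.filter fun qk => g qk = y) : ℝ) ≤ #((range (s * y.1)).filter fun k : ℕ => k % y.1 = y.2) := by
        exact_mod_cast card_le_card_of_injOn _ hmaps3 hinj
    _ ≤ s := by exact_mod_cast card_fibre_le s y.1 y.2 hr'0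

end Literature.NumberTheory.Sieve.HeathBrown2001
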